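import Summits.HodgeConjecture.HodgeConjecture.Theses.MilnorKExponential
import Literature.AlgebraicGeometry.HodgeTheory.SymbolClasses

/-!
# `SymbolClassesAlgebraic` (stmt-HodgeConjecture-17743) · Negative · ceiling and non-load-bearing hypotheses

Negative knowledge for the crux `MilnorKExponential.SymbolClassesAlgebraic` (GK_p), from the standing
disprover's work file `Cruxes/SymbolClassesAlgebraic/Disproof.lean` (§0, §1, §5). Companion of
`Negative/LoadBearing.lean` (boundary, `_false_without_nonzero`, `_false_without_cover`,
anti-vacuity), which needs only the Literature layer; this file needs the route decl itself.

* READ-BACK. The inlined route decl gives the named statement over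
  `HodgeModel.IsSymbolNormalized` / `HodgeModel.HasSymbolCocycle` (`named_of_symbolClassesAlgebraic`;
  componentwise definitional — this lane records one direction only and never proves the decl).
* CEILING. `not_hodgeConjecture_of_not_symbolClassesAlgebraic`: given the route's support item
  `SymbolClassesHodgeType` (`L ⊆ Hdg`: a rational symbol class is of type `(p,p)`), every refutation
  of the crux refutes the Hodge conjecture — no `_refuted` theorem exists short of a counterexample
  to HC (or a typing bug in `L ⊆ Hdg`).
* NOT LOAD-BEARING (for the truth value): normalisation and `Fintype ι` (dropping them only strengthens
  the statement: `not_without_norm_of_not_symbolClassesAlgebraic`,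
  `not_without_fintype_of_not_symbolClassesAlgebraic`), and `IsRationalClass c` (`algebraicClasses` is
  a `ℂ`-subspace: `smul_mem_algebraicClasses_of_symbolClassesAlgebraic`).
Refuter seat refuter-cdisprove-stmt-HodgeConjecture-17743-0 (cdisprove cycle 1), 2026-08-17.
-/

noncomputable section

-- The mandated namespace `Summit.<P>.<Sub>.Theorems.…` repeats `HodgeConjecture` (single-conjunct summit).
set_option linter.dupNamespace false

namespace Summit.HodgeConjecture.HodgeConjecture.Theorems.SymbolClassesAlgebraic.Negative.Ceiling

open scoped Manifold
open Literature.AlgebraicGeometry.HodgeTheory Literature.AlgebraicGeometry.Motives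
  Literature.Geometry.Kaehler Literature.NumberTheory.Transcendental
open Summit.HodgeConjecture.HodgeConjecture.Theses.MilnorKExponential
  (SymbolClassesAlgebraic SymbolClassesHodgeType)

/-! ### The route decl in named form (one direction only: this lane never proves the decl) -/

/-- **Read-back**: the inlined route decl `SymbolClassesAlgebraic` gives the statement "a rational
class with a symbol cocycle (`HodgeModel.HasSymbolCocycle`) on a symbol-normalised Hodge model
(`HodgeModel.IsSymbolNormalized`) is algebraic" (componentwise definitional; the two cocycle clauses
are bundled as `IsMilnorSymbolCocycle`; the converse repackaging is equally definitional but is a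
prover's business). [folklore] -/
theorem named_of_symbolClassesAlgebraic (h : SymbolClassesAlgebraic) ⦃n : ℕ⦄ ⦃X : SchemeOver ℂ⦄
    (hX : IsSmoothProjective n X) (q : ℕ) (c : complexBetti X (2 * (q + 1))) (hc : IsRationalClass c)
    (hs : ∃ A : HodgeModel n X, A.IsSymbolNormalized q ∧ A.HasSymbolCocycle q c) :
    c ∈ algebraicClasses X (q + 1) := by
  obtain ⟨A, hN, ι, hι, U, hU, hcov, σ, ⟨hg, hco⟩, θ, m, hm, hT, hdR⟩ := hs
  exact h hX q c hc ⟨A, hN, ι, hι, U, hU, hcov, σ, hg, hco, θ, m, hm, hT, hdR⟩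

/-! ### Ceiling: a counterexample to the crux is a counterexample to the Hodge conjecture -/

/-- **`¬ GK ⇒ ¬ HC`** (given the typing item `L ⊆ Hdg`): a rational symbol class is of Hodge type
`(p,p)` by the route's support item `SymbolClassesHodgeType`, hence algebraic under the Hodge
conjecture; so every counterexample to the crux is a counterexample to the Hodge conjecture, and the
crux is refutable only by refuting the summit (or the typing item). [cite: VoisinHodgeI2002, §7.1.1 and §11.3] -/
theorem not_hodgeConjecture_of_not_symbolClassesAlgebraic (hT : SymbolClassesHodgeType)
    (h : ¬ SymbolClassesAlgebraic) : ¬ _root_.HodgeConjecture :=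
  fun hHC ↦ h fun _ _ hX q c hc hs ↦ (hHC hX).2 (q + 1) c hc (hT hX q c hc hs)

variable {n : ℕ} {X : SchemeOver ℂ}

/-! ### Hypotheses that are not load-bearing for the truth value -/

/-- **Dropping normalisation only strengthens the crux**: a counterexample to the crux is already a
counterexample to the un-normalised form (census S⁺₁; the converse — the free scalar of `A.deRham` is
invisible — needs uniqueness of analytification and the scalar rigidity of natural de Rham
comparisons, not available here). So NORM cannot be shown load-bearing. [folklore] -/
theorem not_without_norm_of_not_symbolClassesAlgebraic (h : ¬ SymbolClassesAlgebraic) :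
    ¬ (∀ ⦃n : ℕ⦄ ⦃X : SchemeOver ℂ⦄, IsSmoothProjective n X →
        ∀ (q : ℕ) (c : complexBetti X (2 * (q + 1))), IsRationalClass c →
          (∃ A : HodgeModel n X, A.HasSymbolCocycle q c) → c ∈ algebraicClasses X (q + 1)) := by
  intro h'
  refine h fun n X hX q c hc hs ↦ ?_
  obtain ⟨A, -, ι, hι, U, hU, hcov, σ, hg, hco, θ, m, hm, hT, hdR⟩ := hs
  exact h' hX q c hc ⟨A, ι, hι, U, hU, hcov, σ, ⟨hg, hco⟩, θ, m, hm, hT, hdR⟩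

/-- **Dropping `Fintype ι` only strengthens the crux**: a counterexample to the crux is already a
counterexample over arbitrary covers (`X^an` being compact, the converse holds mathematically by
refining to a finite subcover). [folklore] -/
theorem not_without_fintype_of_not_symbolClassesAlgebraic (h : ¬ SymbolClassesAlgebraic) :
    ¬ (∀ ⦃n : ℕ⦄ ⦃X : SchemeOver ℂ⦄, IsSmoothProjective n X →
        ∀ (q : ℕ) (c : complexBetti X (2 * (q + 1))), IsRationalClass c →
          (∃ A : HodgeModel n X, A.IsSymbolNormalized q ∧
            ∃ (ι : Type) (U : ι → Set A.carrier) (hU : ∀ i, IsOpen (U i))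
              (_ : ∀ x, ∃ i, x ∈ U i)
              (σ : (Fin (q + 2) → ι) → ((Fin (q + 1) → (A.carrier → ℂ)) →₀ ℤ))
              (_ : IsMilnorSymbolCocycle A.model U σ)
              (θ : cclosedSmoothForms A.model A.carrier (2 * q + 1 + 1)) (m : ℤ),
              m ≠ 0 ∧ IsTransgression hU q (fun J ↦ symbolForm A.model (q + 1) (σ J)) θ ∧
                A.deRham A.carrier (2 * q + 1 + 1)
                    (complexDeRhamCohomology.mk A.model A.carrier (2 * q + 1 + 1) θ) =
                  (m : ℂ) • A.pullback (2 * q + 1 + 1) c) →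
          c ∈ algebraicClasses X (q + 1)) := by
  intro h'
  refine h fun n X hX q c hc hs ↦ ?_
  obtain ⟨A, hN, ι, -, U, hU, hcov, σ, hg, hco, θ, m, hm, hT, hdR⟩ := hs
  exact h' hX q c hc ⟨A, hN, ι, U, hU, hcov, σ, ⟨hg, hco⟩, θ, m, hm, hT, hdR⟩

/-- **`IsRationalClass c` is invisible to the conclusion**: `algebraicClasses X p` is a `ℂ`-subspace,
so under the crux every COMPLEX multiple of a rational symbol class is algebraic, although such a
multiple is in general neither rational nor a symbol class. [folklore] -/
theorem smul_mem_algebraicClasses_of_symbolClassesAlgebraic (h : SymbolClassesAlgebraic)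
    (hX : IsSmoothProjective n X) {q : ℕ} {c : complexBetti X (2 * (q + 1))} (hc : IsRationalClass c)
    (hs : ∃ A : HodgeModel n X, A.IsSymbolNormalized q ∧ A.HasSymbolCocycle q c) (z : ℂ) :
    z • c ∈ algebraicClasses X (q + 1) :=
  Submodule.smul_mem _ z (named_of_symbolClassesAlgebraic h hX q c hc hs)

end Summit.HodgeConjecture.HodgeConjecture.Theorems.SymbolClassesAlgebraic.Negative.Ceiling

end
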